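import Literature.Computability.QuantumComplexity.KitParamsFP
import HarnessLib

/-!
# The kit inputs of the Grover–Rudolph and Fourier level words, on codes

Topic `Literature/Computability/QuantumComplexity`; the S3/S4 PLUG of the UNIFORMITY of Regev's sampler ([Regev2009, Lemma 3.14, proof];
Arora–Barak §6.2): the level word `GRStage.levelA D j` (`GRStageAbstract.lean`) reads, besides the clean block, the kit data
`(kit.cr :: kit.as).map val`, `kit.cr`, `(kit.as ++ kit.region).map val`, `kit.hs.map val`, the flag program
`(grOps kit t fs).map (ClOp.map val) = (gpOf ps dsz k).gopsA ((insGR t fs).map val) ((GRWord.prog k).compile (thrWd k) 0 0)`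
(`GenKitWords.map_val_grOps`) and the flag wire `(gpOf ps dsz k).gflagA (…)` (`val_grFlag`); the Fourier round word reads the same lists of
`QFTKit.kit κ k` and `(gpOf κ k).gopsA [d0, j, l] ((QFTWord.prog k j l).compile (thrWd k) 0 0)` (`map_val_phaseOps`). With the kit RECORDS on
codes (`GenKit.gpOf_GR_codeFP`, `QFTKit.gpOf_codeFP`, `KitParamsFP.lean`) and the record API on codes (`GP.cr_n`, `as_fp`, `hs_fp`, `region_fp`,
`gopsA_fp`, `gflagA_fp`, `GRA_fp`, `GenKitFP.lean`) every one of these inputs is a polynomial-time function of the context: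

* abstract side: `GenKit.kit_had_val`, `GenKit.kit_asRegion_val` (the kit's wire lists ARE the record's lists);
* `GenKit.hadA_codeFP_of`, `crA_codeFP_of`, `asRegionA_codeFP_of`, `hsA_codeFP_of`, `GRA_codeFP_of`, **`grOpsA_codeFP_of`**, **`grFlagA_codeFP_of`**;
* `QFTKit.hadA_codeFP_of`, `crA_codeFP_of`, `asRegionA_codeFP_of`, `hsA_codeFP_of`, `GRA_codeFP_of`, **`phaseOpsA_codeFP_of`**, **`phaseFlagA_codeFP_of`**.

Everything is proved; no named fact is introduced.

## References

* O. Regev, J. ACM 56(6) (2009), Lemma 3.14 (proof) [Regev2009].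
* S. Arora, B. Barak, *Computational Complexity: A Modern Approach*, CUP 2009, §6.2 [AroraBarak2009].
* M. A. Nielsen, I. L. Chuang, *Quantum Computation and Quantum Information*, CUP 2010, §5.1 [NielsenChuang2010].
-/

noncomputable section

namespace Literature.Computability.QuantumComplexity

open _root_.Computability Cryptography Complexity Complexity.CodeFP SLP RevDesc AJLCore

variable {σ : Type} {eσ : σ → List Bool}

namespace GenKit

section Abstract

variable (ps : List BExpr) (dsz k : ℕ)

/-- The selector-and-averaging wire list of the kit is the record's. [folklore] -/
theorem kit_had_val : ((kit ps dsz k).cr :: (kit ps dsz k).as).map Fin.val = (gpOf ps dsz k).cr :: (gpOf ps dsz k).as := by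
  rw [List.map_cons, kit_as_val]; rfl

/-- The reflected wire list of the kit is the record's. [folklore] -/
theorem kit_asRegion_val : ((kit ps dsz k).as ++ (kit ps dsz k).region).map Fin.val = (gpOf ps dsz k).as ++ (gpOf ps dsz k).region := by
  rw [List.map_append, kit_as_val, kit_region_val]

end Abstract

variable {dsz kk : σ → ℕ} (hd : CodeFP eσ unE dsz) (hk : CodeFP eσ unE kk)
include hd hk

/-- `cr :: as` on codes. [folklore] -/
theorem hadA_codeFP_of : CodeFP eσ (rawE natE) (fun c => (gpOf (GRData.ps (kk c)) (dsz c) (kk c)).cr :: (gpOf (GRData.ps (kk c)) (dsz c) (kk c)).as) :=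
  ((rawCons natE).comp ((GP.cr_n.comp (gpOf_GR_codeFP hd hk)).pair (GP.as_fp.comp (gpOf_GR_codeFP hd hk))) :)

/-- `cr` on codes. [folklore] -/
theorem crA_codeFP_of : CodeFP eσ natE (fun c => (gpOf (GRData.ps (kk c)) (dsz c) (kk c)).cr) := (GP.cr_n.comp (gpOf_GR_codeFP hd hk) :)

/-- `as ++ region` on codes. [folklore] -/
theorem asRegionA_codeFP_of :
    CodeFP eσ (rawE natE) (fun c => (gpOf (GRData.ps (kk c)) (dsz c) (kk c)).as ++ (gpOf (GRData.ps (kk c)) (dsz c) (kk c)).region) :=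
  ((rawAppend natE).comp ((GP.as_fp.comp (gpOf_GR_codeFP hd hk)).pair (GP.region_fp.comp (gpOf_GR_codeFP hd hk))) :)

/-- `hs` on codes. [folklore] -/
theorem hsA_codeFP_of : CodeFP eσ (rawE natE) (fun c => (gpOf (GRData.ps (kk c)) (dsz c) (kk c)).hs) := (GP.hs_fp.comp (gpOf_GR_codeFP hd hk) :)

/-- The kit's reflection word on codes. [folklore] -/
theorem GRA_codeFP_of : CodeFP eσ (rawE agE0) (fun c => (gpOf (GRData.ps (kk c)) (dsz c) (kk c)).GRA) := (GP.GRA_fp.comp (gpOf_GR_codeFP hd hk) :)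

omit hd hk in
/-- **The Grover–Rudolph flag program's clean operations on codes**, for inputs given on codes in an indexed context.
[cite: Regev2009, Lemma 3.14 (proof)] [cite: AroraBarak2009, §6.2 (proof of Thm. 6.15)] -/
theorem grOpsA_codeFP_of {ι : Type} {eι : ι → List Bool} {ins : σ → ι → List ℕ} (hd : CodeFP eσ unE dsz) (hk : CodeFP eσ unE kk)
    (hins : CodeFP (pairE eσ eι) (rawE natE) (fun q => ins q.1 q.2)) :
    CodeFP (pairE eσ eι) (rawE clopE) (fun q => (gpOf (GRData.ps (kk q.1)) (dsz q.1) (kk q.1)).gopsA (ins q.1 q.2)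
      ((GRWord.prog (kk q.1)).compile (thrWd (kk q.1)) 0 0)) :=
  (GP.gopsA_fp.comp (((gpOf_GR_codeFP hd hk).comp (fst _ _)).pair (hins.pair ((prog_compile_codeFP_of hk).comp (fst _ _)))) :)

/-- **The Grover–Rudolph flag wire on codes.** [cite: Regev2009, Lemma 3.14 (proof)] -/
theorem grFlagA_codeFP_of :
    CodeFP eσ natE (fun c => (gpOf (GRData.ps (kk c)) (dsz c) (kk c)).gflagA ((GRWord.prog (kk c)).compile (thrWd (kk c)) 0 0)) :=
  (GP.gflagA_fp.comp ((gpOf_GR_codeFP hd hk).pair (prog_compile_codeFP_of hk)) :)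

end GenKit

namespace QFTKit

variable {κ k : σ → ℕ} (hκ : CodeFP eσ unE κ) (hk : CodeFP eσ unE k)
include hκ hk

/-- `cr :: as` on codes. [folklore] -/
theorem hadA_codeFP_of : CodeFP eσ (rawE natE) (fun c => (gpOf (κ c) (k c)).cr :: (gpOf (κ c) (k c)).as) :=
  ((rawCons natE).comp ((GP.cr_n.comp (gpOf_codeFP hκ hk)).pair (GP.as_fp.comp (gpOf_codeFP hκ hk))) :)

/-- `cr` on codes. [folklore] -/
theorem crA_codeFP_of : CodeFP eσ natE (fun c => (gpOf (κ c) (k c)).cr) := (GP.cr_n.comp (gpOf_codeFP hκ hk) :)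

/-- `d0` on codes. [folklore] -/
theorem d0A_codeFP_of : CodeFP eσ natE (fun c => (gpOf (κ c) (k c)).d0) := (GP.d0_n.comp (gpOf_codeFP hκ hk) :)

/-- `as ++ region` on codes. [folklore] -/
theorem asRegionA_codeFP_of : CodeFP eσ (rawE natE) (fun c => (gpOf (κ c) (k c)).as ++ (gpOf (κ c) (k c)).region) :=
  ((rawAppend natE).comp ((GP.as_fp.comp (gpOf_codeFP hκ hk)).pair (GP.region_fp.comp (gpOf_codeFP hκ hk))) :)

/-- `hs` on codes. [folklore] -/
theorem hsA_codeFP_of : CodeFP eσ (rawE natE) (fun c => (gpOf (κ c) (k c)).hs) := (GP.hs_fp.comp (gpOf_codeFP hκ hk) :)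

/-- The kit's reflection word on codes. [folklore] -/
theorem GRA_codeFP_of : CodeFP eσ (rawE agE0) (fun c => (gpOf (κ c) (k c)).GRA) := (GP.GRA_fp.comp (gpOf_codeFP hκ hk) :)

omit hκ hk in
/-- **The controlled-phase flag program's clean operations on codes**, for the pair `(j, l)` (in binary) and the denominator exponent
`m` (in unary) given on codes in an indexed context. [cite: Regev2009, Lemma 3.14 (proof)] [cite: NielsenChuang2010, §5.1] -/
theorem phaseOpsA_codeFP_of {ι : Type} {eι : ι → List Bool} {j l m : σ → ι → ℕ} (hκ : CodeFP eσ unE κ) (hk : CodeFP eσ unE k)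
    (hj : CodeFP (pairE eσ eι) natE (fun q => j q.1 q.2)) (hl : CodeFP (pairE eσ eι) natE (fun q => l q.1 q.2))
    (hm : CodeFP (pairE eσ eι) unE (fun q => m q.1 q.2)) :
    CodeFP (pairE eσ eι) (rawE clopE) (fun q => (gpOf (κ q.1) (k q.1)).gopsA [(gpOf (κ q.1) (k q.1)).d0, j q.1 q.2, l q.1 q.2]
      ((qftPhaseB (k q.1) (cosThr (m q.1 q.2) (k q.1)) (sinThr (m q.1 q.2) (k q.1))).compile (thrWd (k q.1)) 0 0)) := by
  have hins : CodeFP (pairE eσ eι) (rawE natE) (fun q => [(gpOf (κ q.1) (k q.1)).d0, j q.1 q.2, l q.1 q.2]) :=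
    ((rawCons natE).comp (((d0A_codeFP_of hκ hk).comp (fst _ _)).pair ((rawCons natE).comp (hj.pair ((rawSingleton natE).comp hl)))) :)
  exact (GP.gopsA_fp.comp (((gpOf_codeFP hκ hk).comp (fst _ _)).pair (hins.pair
    (qftPhase_compile_codeFP.comp ((hk.comp (fst _ _)).pair hm)))) :)

omit hκ hk in
/-- **The controlled-phase flag wire on codes.** [cite: Regev2009, Lemma 3.14 (proof)] -/
theorem phaseFlagA_codeFP_of {ι : Type} {eι : ι → List Bool} {m : σ → ι → ℕ} (hκ : CodeFP eσ unE κ) (hk : CodeFP eσ unE k)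
    (hm : CodeFP (pairE eσ eι) unE (fun q => m q.1 q.2)) :
    CodeFP (pairE eσ eι) natE (fun q => (gpOf (κ q.1) (k q.1)).gflagA
      ((qftPhaseB (k q.1) (cosThr (m q.1 q.2) (k q.1)) (sinThr (m q.1 q.2) (k q.1))).compile (thrWd (k q.1)) 0 0)) :=
  (GP.gflagA_fp.comp (((gpOf_codeFP hκ hk).comp (fst _ _)).pair (qftPhase_compile_codeFP.comp ((hk.comp (fst _ _)).pair hm))) :)

end QFTKit

end Literature.Computability.QuantumComplexity

end
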